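import Summits.SmoothPoincare4.SmoothPoincare4.Theorems.CylinderEntropyCylinderRungTwoDissipationBudget
import Summits.SmoothPoincare4.SmoothPoincare4.Theorems.CylinderEntropyCylinderRungTwoGoodTimes
import Mathlib.MeasureTheory.Integral.IntervalIntegral.FundThmCalculus
import HarnessLib

/-!
# Route `CylinderEntropy`, crux `CylinderRungTwo` (stmt-SmoothPoincare4-7631), line `killing-flux`:
# the SHIFT LEMMA along a cylinder flow (registered helper `helper_shiftLemma`, lead c4, wave 2, F1)

Along a smooth mean curvature flow `IsCylinderMCF M F ν T`
(`CylinderEntropyCylinderRungTwoKillingFluxDefs.lean`) of closed embedded cross-sections of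
`N = S⁴ × ℝ ⊂ ℝ⁶`, two time slices are close as measures when little area is dissipated between
them: for a `C¹` test function `φ : ℝ⁶ → ℝ` with `|φ| ≤ A₀`, `‖Dφ‖ ≤ A₁` on `F([t', t] × M)`,

  `|∫ φ dμ_t - ∫ φ dμ_{t'}| ≤ A₀ D + A₁ √((t - t') · μH⁴(F_{t'}(M)) · D)`,

`μ_r = (F r)^* μH⁴` (`Measure.comap (F r) μH[4]`), `D = ∫_{t'}^t ∫ ‖∂_r F‖² dμ_r dr` the dissipation
(`‖∂_r F‖ = |H|`): the smooth case of the mass-continuity estimate of Brakke flows (Brakke 1978, §3).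

Proof (`IsCylinderMCF.abs_integral_comp_sub_le`, after restarting the flow at `t'`,
`IsCylinderMCF.of_le`): write `g(r) = ∫ φ(F r ·) dμ_r = ∫ φ(F r w) θ_r(w) dμ_T(w)` against the fixed
area measure of `F_T^*δ` (`θ_r = √D_r/√D_T` the ratio of the coordinate-frame Gram determinants,
landed `IsCylinderMCF.integral_riemannianMeasure_eq`); the landed transport formula
`IsCylinderMCF.hasDerivAt_integral_mul_density` gives `g'(r) = ∫ (Dφ(∂_r F) - ‖∂_r F‖² φ) dμ_r` on
`(T, t)`, so `|g'| ≤ A₀Φ + (A₁/2)(λ μ_T(M) + λ⁻¹Φ)` for every `λ > 0` (`Φ(r) = ∫ ‖∂_r F‖² dμ_r`,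
Peter–Paul and `θ_r ≤ 1`); the FTC inequalities for right derivatives
(`intervalIntegral.sub_le_integral_of_hasDeriv_right_of_le`; the bound is integrable because
`Φ = -d/dr μ_r(M)` is, exactly as in `…DissipationBudget.lean`) and the optimal `λ` give the claim,
and the dictionary `c · (F r)^* μH⁴ = μ_r` (`μHE⁴ = c • μH⁴`) translates it to the registered form.
Everything here is PROVED (no `sorry`, no definitions, no named facts).

References: K. Brakke, *The motion of a surface by its mean curvature* (1978), §3; G. Huisken,
J. Differential Geom. 20 (1984), §3; C. Mantegazza, *Lecture Notes on Mean Curvature Flow* (2011),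
Prop. 2.3.3; H. Federer, *Geometric Measure Theory* (1969), 3.2.3 and 3.2.46.
-/

-- the prescribed namespace `Summit.SmoothPoincare4.SmoothPoincare4.…` repeats `SmoothPoincare4`
set_option linter.dupNamespace false

noncomputable section

open Bundle Set Function Filter MeasureTheory Module
open scoped Manifold ContDiff Topology RealInnerProductSpace BigOperators ENNReal NNReal

namespace Summit.SmoothPoincare4.SmoothPoincare4.Cruxes.CylinderRungTwo.KillingFlux

open Literature.Geometry.Riemannian Literature.Geometry.Riemannian.EuclideanHypersurface
open Literature.Geometry.Lorentzian Literature.Geometry.Lorentzian.PseudoRiemannianMetric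
open Literature.Analysis.Calculus

/-! ## Three elementary real inequalities -/

section Elementary

/-- Peter–Paul with a weight `θ ∈ [0, 1]`: `A n θ ≤ (A/2)(λ + λ⁻¹ n² θ)` for `A ≥ 0`, `λ > 0`
(`2λnθ ≤ λ² + n²θ` since `θ ≤ 1`). [folklore] -/
theorem mul_mul_le_half_mul_add {A n θ l : ℝ} (hA : 0 ≤ A) (hθ0 : 0 ≤ θ) (hθ1 : θ ≤ 1)
    (hl : 0 < l) : A * n * θ ≤ A / 2 * (l + l⁻¹ * (n ^ 2 * θ)) := by
  have key : n * θ ≤ (l + l⁻¹ * (n ^ 2 * θ)) / 2 := by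
    rw [le_div_iff₀ two_pos, inv_mul_eq_div, ← sub_nonneg]
    have h2 : l + n ^ 2 * θ / l - n * θ * 2 = ((l - n * θ) ^ 2 + n ^ 2 * θ * (1 - θ)) / l := by
      field_simp
      ring
    rw [h2]
    have h3 : 0 ≤ n ^ 2 * θ * (1 - θ) := mul_nonneg (mul_nonneg (sq_nonneg n) hθ0) (sub_nonneg.2 hθ1)
    exact div_nonneg (by nlinarith [sq_nonneg (l - n * θ)]) hl.le
  calc A * n * θ = A * (n * θ) := mul_assoc _ _ _
    _ ≤ A * ((l + l⁻¹ * (n ^ 2 * θ)) / 2) := mul_le_mul_of_nonneg_left key hA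
    _ = A / 2 * (l + l⁻¹ * (n ^ 2 * θ)) := by ring

/-- Degenerate Peter–Paul: if `x ≤ a + (b/2) λ P` for every `λ > 0` (`P ≥ 0`), then `x ≤ a`
(`λ → 0`). [folklore] -/
theorem le_of_forall_pos_le_add_mul {x a b P : ℝ} (hP : 0 ≤ P)
    (h : ∀ l : ℝ, 0 < l → x ≤ a + b / 2 * (l * P)) : x ≤ a := by
  refine le_of_forall_pos_le_add fun ε hε => ?_
  refine (h _ (show 0 < ε / (|b| * P + 1) by positivity)).trans ?_
  have h1 : b / 2 * (ε / (|b| * P + 1) * P) = (b * P) / (|b| * P + 1) * (ε / 2) := by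
    field_simp
  have h2 : (b * P) / (|b| * P + 1) ≤ 1 := by
    rw [div_le_one (by positivity)]
    nlinarith [le_abs_self b, abs_nonneg b]
  rw [h1]
  nlinarith

/-- Optimising Peter–Paul: if `x ≤ a + (b/2)(λP + λ⁻¹Q)` for every `λ > 0` (`P, Q ≥ 0`), then
`x ≤ a + b √(PQ)` (`λ = √Q/√P` if `P, Q > 0`; `λ → 0` or `λ → ∞` in the degenerate cases). [folklore] -/
theorem le_add_mul_sqrt_of_forall_pos {x a b P Q : ℝ} (hP : 0 ≤ P) (hQ : 0 ≤ Q)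
    (h : ∀ l : ℝ, 0 < l → x ≤ a + b / 2 * (l * P + l⁻¹ * Q)) :
    x ≤ a + b * Real.sqrt (P * Q) := by
  rcases hP.eq_or_lt with rfl | hP0
  · rw [zero_mul, Real.sqrt_zero, mul_zero, add_zero]
    refine le_of_forall_pos_le_add_mul (b := b) hQ fun l hl => ?_
    simpa only [mul_zero, zero_add, inv_inv] using h l⁻¹ (inv_pos.2 hl)
  rcases hQ.eq_or_lt with rfl | hQ0
  · rw [mul_zero, Real.sqrt_zero, mul_zero, add_zero]
    exact le_of_forall_pos_le_add_mul hP fun l hl => by simpa only [mul_zero, add_zero] using h l hl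
  obtain ⟨p, hp, rfl⟩ : ∃ p, 0 < p ∧ P = p ^ 2 := ⟨Real.sqrt P, Real.sqrt_pos.2 hP0, (Real.sq_sqrt hP).symm⟩
  obtain ⟨q, hq, rfl⟩ : ∃ q, 0 < q ∧ Q = q ^ 2 := ⟨Real.sqrt Q, Real.sqrt_pos.2 hQ0, (Real.sq_sqrt hQ).symm⟩
  rw [Real.sqrt_mul (sq_nonneg p), Real.sqrt_sq hp.le, Real.sqrt_sq hq.le]
  refine (h (q / p) (div_pos hq hp)).trans (le_of_eq ?_)
  field_simp
  ring

/-- `√(s · (c x) · (c y)) = c √(s x y)` for `c ≥ 0` (the Hausdorff normalisation constant pulled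
out of the square root). [folklore] -/
theorem sqrt_mul_mul_mul_eq {s c x y : ℝ} (hc : 0 ≤ c) :
    Real.sqrt (s * (c * x) * (c * y)) = c * Real.sqrt (s * x * y) := by
  rw [show s * (c * x) * (c * y) = c * c * (s * x * y) by ring, Real.sqrt_mul (mul_self_nonneg _),
    Real.sqrt_mul_self hc]

end Elementary

/-! ## The shift lemma along a cylinder flow -/

section Shift

variable {M : Type} [TopologicalSpace M] [ChartedSpace (EuclideanSpace ℝ (Fin 4)) M]
  [IsManifold (𝓡 4) ∞ M] {F ν : ℝ → M → EuclideanSpace ℝ (Fin 6)} {T : ℝ}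
  [T2Space M] [CompactSpace M] [MeasurableSpace M] [BorelSpace M]

/-- **Bochner integrals against `(F s)^* μH⁴` are integrals against the area measure**: for `s ≥ T`,
`ψ : ℝ⁶ → ℝ` and `μHE⁴ = c • μH⁴`, `c · ∫_M ψ(F s x) d((F s)^* μH⁴)(x) = ∫_M ψ(F s w) dμ_s(w)`,
`μ_s` the Riemannian measure of `F_s^*δ` (`F s` is a closed measurable embedding,
`MeasurableEmbedding.map_comap`, and the area formula `IsCylinderMCF.smul_setIntegral_range_eq`).
[cite: Federer1969, 3.2.3 and 3.2.46] -/
theorem IsCylinderMCF.mul_integral_comp_comap_eq (h : IsCylinderMCF M F ν T) {s : ℝ} (hs : T ≤ s)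
    {c : ℝ≥0} (hc : (μHE[4] : Measure (EuclideanSpace ℝ (Fin 6))) =
      c • (μH[4] : Measure (EuclideanSpace ℝ (Fin 6)))) (ψ : EuclideanSpace ℝ (Fin 6) → ℝ) :
    (c : ℝ) * ∫ x, ψ (F s x) ∂(Measure.comap (F s) (μH[4] : Measure (EuclideanSpace ℝ (Fin 6)))) =
      ∫ w, ψ (F s w) ∂riemannianMeasure ((euclideanMetric (EuclideanSpace ℝ (Fin 6))).inducedRiemannianMetric
        (F s) contMDiff_pullbackBilin_holds (h.isSpacelikeImmersion s hs)) := by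
  have hme : MeasurableEmbedding (F s) :=
    ((h.isSpacelikeImmersion s hs).contMDiff.continuous.isClosedEmbedding
      (h.injective hs)).measurableEmbedding
  have h1 : ∫ x, ψ (F s x) ∂(Measure.comap (F s) (μH[4] : Measure (EuclideanSpace ℝ (Fin 6)))) =
      ∫ z in range (F s), ψ z ∂μH[4] := by
    rw [← hme.map_comap, hme.integral_map]
  rw [h1, ← smul_eq_mul, h.smul_setIntegral_range_eq hs hc ψ]

/-- **The shift lemma from the initial time** (the case `t' = T` of `helper_shiftLemma`): for a
`C¹` test function `φ` with `|φ| ≤ A₀`, `‖Dφ‖ ≤ A₁` along `F([T, t] × M)`,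
`|∫ φ dμ_t - ∫ φ dμ_T| ≤ A₀ D + A₁ √((t - T) μH⁴(F_T(M)) D)`, `μ_r = (F r)^* μH⁴`,
`D = ∫⁻_{[T,t]} ∫⁻ ‖∂_r F‖² dμ_r dr` the dissipation. Proof: with `g(r) = ∫ φ(F r ·) dμ_r` written
against the fixed area measure of `F_T^*δ` through the density `θ_r = √D_r/√D_T`, the transport
formula (`IsCylinderMCF.hasDerivAt_integral_mul_density`) gives
`g' = ∫ (Dφ(∂_r F) - ‖∂_r F‖² φ) dμ_r`, whence, by Peter–Paul with a parameter `λ > 0` and `θ_r ≤ 1`,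
`|g'(r)| ≤ A₀ Φ(r) + (A₁/2)(λ μ_T(M) + λ⁻¹ Φ(r))`, `Φ(r) = ∫ ‖∂_r F‖² dμ_r`; the FTC inequalities for
right derivatives (`intervalIntegral.sub_le_integral_of_hasDeriv_right_of_le`, the bound being
integrable because `Φ = -d/dr μ_r(M)` is) and the optimal `λ` give the claim, after translating the
area measures into `(F r)^* μH⁴ = c⁻¹ μ_r`. [cite: Huisken1984, §3] [cite: Mantegazza2011, Prop. 2.3.3] -/
theorem IsCylinderMCF.abs_integral_comp_sub_le (h : IsCylinderMCF M F ν T)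
    {φ : EuclideanSpace ℝ (Fin 6) → ℝ} (hφ : ContDiff ℝ 1 φ) {A₀ A₁ t : ℝ} (ht : T ≤ t)
    (hB : ∀ r ∈ Icc T t, ∀ x : M, |φ (F r x)| ≤ A₀ ∧ ‖fderiv ℝ φ (F r x)‖ ≤ A₁) :
    |∫ x, φ (F t x) ∂(Measure.comap (F t) (μH[4] : Measure (EuclideanSpace ℝ (Fin 6)))) -
        ∫ x, φ (F T x) ∂(Measure.comap (F T) (μH[4] : Measure (EuclideanSpace ℝ (Fin 6))))| ≤
      A₀ * (∫⁻ r in Icc T t, ∫⁻ x, ENNReal.ofReal (‖deriv (fun s => F s x) r‖ ^ 2)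
          ∂(Measure.comap (F r) (μH[4] : Measure (EuclideanSpace ℝ (Fin 6))))).toReal +
        A₁ * Real.sqrt ((t - T) * (μH[4] (range (F T))).toReal *
          (∫⁻ r in Icc T t, ∫⁻ x, ENNReal.ofReal (‖deriv (fun s => F s x) r‖ ^ 2)
            ∂(Measure.comap (F r) (μH[4] : Measure (EuclideanSpace ℝ (Fin 6))))).toReal) := by
  obtain ⟨c, hc0, hHE⟩ := exists_euclideanHausdorff_six_eq_smul
  have hc0' : (c : ℝ≥0∞) ≠ 0 := ENNReal.coe_ne_zero.2 hc0
  have hcpos : (0 : ℝ) < c := NNReal.coe_pos.2 (pos_iff_ne_zero.2 hc0)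
  obtain ⟨U, hU, hIU, hFj⟩ := h.contMDiffOn
  -- notation: the metrics, the reference measure `μ_T`, the densities, the integrands
  set gm : ∀ r, T ≤ r → ContMDiffRiemannianMetric (𝓡 4) ∞ (EuclideanSpace ℝ (Fin 4))
      (TangentSpace (𝓡 4) : M → Type _) := fun r hr =>
    (euclideanMetric (EuclideanSpace ℝ (Fin 6))).inducedRiemannianMetric (F r)
      contMDiff_pullbackBilin_holds (h.isSpacelikeImmersion r hr) with hgm
  set μT := riemannianMeasure (gm T le_rfl) with hμT
  haveI : IsFiniteMeasure μT := isFiniteMeasure_riemannianMeasure _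
  set D : ℝ → M → ℝ := fun r w => (Matrix.of fun i j =>
    (euclideanMetric (EuclideanSpace ℝ (Fin 6))).inducedBilin (𝓡 4) (F r) w
      ((trivializationAt (EuclideanSpace ℝ (Fin 4)) (TangentSpace (𝓡 4)) w).localFrame
        (EuclideanSpace.basisFun (Fin 4) ℝ).toBasis i w)
      ((trivializationAt (EuclideanSpace ℝ (Fin 4)) (TangentSpace (𝓡 4)) w).localFrame
        (EuclideanSpace.basisFun (Fin 4) ℝ).toBasis j w)).det with hD
  set θ : ℝ → M → ℝ := fun r w => Real.sqrt (D r w) / Real.sqrt (D T w) with hθ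
  set Hsq : ℝ → M → ℝ := fun r w => ‖deriv (fun s => F s w) r‖ ^ 2 with hHsq
  set f : ℝ → M → ℝ := fun r w => φ (F r w) with hf
  set f' : ℝ → M → ℝ := fun r w => fderiv ℝ φ (F r w) (deriv (fun s => F s w) r) with hf'
  set A : ℝ → ℝ := fun r => ∫ w, (1 : ℝ) * θ r w ∂μT with hA
  set Φ : ℝ → ℝ := fun r => ∫ w, Hsq r w * θ r w ∂μT with hΦ
  set g : ℝ → ℝ := fun r => ∫ w, f r w * θ r w ∂μT with hg
  set g' : ℝ → ℝ := fun r => ∫ w, (f' r w - Hsq r w * f r w) * θ r w ∂μT with hg'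
  set AT : ℝ := (μT univ).toReal with hAT
  -- (1) the densities: chart identification, positivity, continuity, `θ ≤ 1`
  have hDchart : ∀ r (hr : T ≤ r) w,
      chartGramMatrix (gm r hr) w (extChartAt (𝓡 4) w w) = Matrix.of fun i j =>
        (euclideanMetric (EuclideanSpace ℝ (Fin 6))).inducedBilin (𝓡 4) (F r) w
          ((trivializationAt (EuclideanSpace ℝ (Fin 4)) (TangentSpace (𝓡 4)) w).localFrame
            (EuclideanSpace.basisFun (Fin 4) ℝ).toBasis i w)
          ((trivializationAt (EuclideanSpace ℝ (Fin 4)) (TangentSpace (𝓡 4)) w).localFrame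
            (EuclideanSpace.basisFun (Fin 4) ℝ).toBasis j w) :=
    fun r hr w => chartGramMatrix_inducedRiemannianMetric_self_of_immersion (h.isSpacelikeImmersion r hr) w
  have hDpos : ∀ r (hr : T ≤ r) w, 0 < Real.sqrt (D r w) := fun r hr w => by
    have := sqrt_det_chartGramMatrix_pos (gm r hr) w (mem_extChartAt_target w)
    rwa [hDchart r hr w] at this
  have hθcont : ∀ r (hr : T ≤ r), Continuous (θ r) := fun r hr => by
    have hθcan : θ r = fun w =>
        Real.sqrt (chartGramMatrix (gm r hr) w (extChartAt (𝓡 4) w w)).det /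
          Real.sqrt (chartGramMatrix (gm T le_rfl) w (extChartAt (𝓡 4) w w)).det := by
      funext w
      simp only [hθ, hD, hDchart r hr w, hDchart T le_rfl w]
    rw [hθcan]
    exact continuous_sqrt_det_chartGramMatrix_div (gm r hr) (gm T le_rfl)
  have hθpos : ∀ r (hr : T ≤ r) w, 0 < θ r w := fun r hr w =>
    div_pos (hDpos r hr w) (hDpos T le_rfl w)
  have hθle : ∀ r (hr : T ≤ r) w, θ r w ≤ 1 := fun r hr w =>
    (div_le_one (hDpos T le_rfl w)).2
      (h.antitoneOn_sqrt_det_gram_localFrame w (mem_Ici.2 le_rfl) (mem_Ici.2 hr) hr)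
  -- (2) change of the reference measure: `∫ ψ θ^{t₀}_r dμ_{t₀} = ∫ ψ dμ_r`
  have hchangeG : ∀ r (hr : T ≤ r) t₀ (ht₀ : T ≤ t₀) (ψ : M → ℝ),
      ∫ w, ψ w * (Real.sqrt (D r w) / Real.sqrt (D t₀ w)) ∂riemannianMeasure (gm t₀ ht₀) =
        ∫ w, ψ w ∂riemannianMeasure (gm r hr) := fun r hr t₀ ht₀ ψ => by
    rw [h.integral_riemannianMeasure_eq hr ht₀ ψ]
    refine integral_congr_ae (Eventually.of_forall fun w => ?_)
    dsimp only
    rw [smul_eq_mul]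
    exact mul_comm _ _
  -- (3) joint continuity of `f`, `f'` and the chain rule
  have hfcU : ContinuousOn (uncurry f) (U ×ˢ univ) :=
    hφ.continuous.comp_continuousOn hFj.continuousOn
  have hf'cU : ContinuousOn (uncurry f') (U ×ˢ univ) :=
    (((hφ.continuous_fderiv one_ne_zero).comp_continuousOn hFj.continuousOn)).clm_apply
      (continuousOn_timeDeriv hU hFj)
  have hfd : ∀ r ∈ U, ∀ w, HasDerivAt (fun s => f s w) (f' r w) r := fun r hr w =>
    ((hφ.differentiable one_ne_zero) (F r w)).hasFDerivAt.comp_hasDerivAt r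
      (hasDerivAt_slice hU hFj hr w)
  -- (4) the transport formula for `g`, reference measure moved to `μ_T`
  have hgd : ∀ s, T < s → HasDerivAt g (g' s) s := fun s hs => by
    have hTa : T ≤ (T + s) / 2 := by linarith
    have hsI : s ∈ Ioo ((T + s) / 2) (s + 1) := ⟨by linarith, by linarith⟩
    have hIooU : Ioo ((T + s) / 2) (s + 1) ⊆ U := fun r hr =>
      hIU (mem_Ici.2 (by linarith [hr.1]))
    have hmain := h.hasDerivAt_integral_mul_density hTa hsI (f := f) (f' := f')
      (hfcU.mono (Set.prod_mono hIooU subset_rfl)) (hf'cU.mono (Set.prod_mono hIooU subset_rfl))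
      (fun r hr w => hfd r (hIooU hr) w)
    refine (hmain.congr_of_eventuallyEq ?_).congr_deriv ?_
    · filter_upwards [Ici_mem_nhds hs] with r hr
      exact (hchangeG r hr T le_rfl (f r)).trans (hchangeG r hr s hs.le (f r)).symm
    · calc ∫ w, (f' s w - ((euclideanMetric (EuclideanSpace ℝ (Fin 6))).meanCurvature (F s)
              contMDiff_pullbackBilin_holds (h.isSpacelikeImmersion s hs.le) (ν s) w) ^ 2 * f s w)
              ∂riemannianMeasure (gm s hs.le)
          = ∫ w, (f' s w - Hsq s w * f s w) ∂riemannianMeasure (gm s hs.le) :=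
            integral_congr_ae (Eventually.of_forall fun w => by
              simp only [hHsq, h.norm_deriv_sq_eq hs.le w])
        _ = g' s := (hchangeG s hs.le T le_rfl (fun w => f' s w - Hsq s w * f s w)).symm
  -- (5) continuity of `g` on `[T, t]` (right-continuity at `T` by dominated convergence)
  have hgc : ContinuousOn g (Icc T t) := by
    intro s hs
    rcases eq_or_lt_of_le hs.1 with h0 | h0
    · subst h0
      exact (h.continuousWithinAt_integral_mul_density (lt_add_one T) (f := f) (hfcU.mono
        (Set.prod_mono (fun r hr => hIU (mem_Ici.2 hr.1)) subset_rfl))).mono Icc_subset_Ici_self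
    · exact (hgd s h0).continuousAt.continuousWithinAt
  -- (6) the dissipation `Φ = -A'` is integrable on `[T, t]`; the budget `D` in terms of `Φ`
  have hAd : ∀ r, T < r → HasDerivAt A (-Φ r) r := fun r hr => h.hasDerivAt_integral_density hr
  have hAc : ContinuousOn A (Icc T t) := h.continuousOn_integral_density.mono Icc_subset_Ici_self
  have hΦ0 : ∀ r, 0 ≤ Φ r := fun r => integral_nonneg fun w =>
    mul_nonneg (sq_nonneg _) (div_nonneg (Real.sqrt_nonneg _) (Real.sqrt_nonneg _))
  have hAd' : ∀ r ∈ Ioo T t, HasDerivAt (fun r => -A r) (Φ r) r := fun r hr =>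
    (hAd r hr.1).neg.congr_deriv (neg_neg _)
  have hintIoc : IntegrableOn Φ (Ioc T t) :=
    intervalIntegral.integrableOn_deriv_of_nonneg hAc.neg hAd' fun r _ => hΦ0 r
  have hintIcc : IntegrableOn Φ (Icc T t) :=
    (integrableOn_Icc_iff_integrableOn_Ioc enorm_ne_top).2 hintIoc
  set IΦ : ℝ := ∫ r in Ioc T t, Φ r with hIΦ
  have hIΦ0 : 0 ≤ IΦ := setIntegral_nonneg measurableSet_Ioc fun r _ => hΦ0 r
  have hDeq : (∫⁻ r in Icc T t, ∫⁻ x, ENNReal.ofReal (‖deriv (fun s => F s x) r‖ ^ 2)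
      ∂(Measure.comap (F r) (μH[4] : Measure (EuclideanSpace ℝ (Fin 6))))) =
        (c : ℝ≥0∞)⁻¹ * ENNReal.ofReal IΦ := by
    rw [setLIntegral_congr_fun measurableSet_Icc
        (fun r hr => h.lintegral_comap_normSq_deriv_eq hr.1 hc0 hHE),
      lintegral_const_mul' _ _ (ENNReal.inv_ne_top.2 hc0'), setLIntegral_congr Ioc_ae_eq_Icc.symm,
      ← ofReal_integral_eq_lintegral_ofReal hintIoc (Eventually.of_forall fun r => hΦ0 r)]
  have hIΦc : IΦ = (c : ℝ) * (∫⁻ r in Icc T t, ∫⁻ x, ENNReal.ofReal (‖deriv (fun s => F s x) r‖ ^ 2)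
      ∂(Measure.comap (F r) (μH[4] : Measure (EuclideanSpace ℝ (Fin 6))))).toReal := by
    rw [hDeq, ENNReal.toReal_mul, ENNReal.toReal_inv, ENNReal.coe_toReal, ENNReal.toReal_ofReal hIΦ0,
      ← mul_assoc, mul_inv_cancel₀ hcpos.ne', one_mul]
  -- (7) the area at time `T`: `μ_T(M) = c · μH⁴(F_T(M))`
  have hATeq : AT = (c : ℝ) * (μH[4] (range (F T))).toReal := by
    have h1 := h.euclideanHausdorffMeasure_range_eq (t := T) le_rfl
    rw [hHE, Measure.coe_nnreal_smul_apply] at h1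
    rw [hAT, ← h1, ENNReal.toReal_mul, ENNReal.coe_toReal]
  -- (8) the bound on `g'` on `(T, t)`: Peter–Paul with a parameter `λ > 0`
  have hbound : ∀ {l : ℝ}, 0 < l → ∀ r ∈ Ioo T t,
      |g' r| ≤ A₀ * Φ r + A₁ / 2 * (l * AT + l⁻¹ * Φ r) := by
    intro l hl r hr
    have hrT : T ≤ r := hr.1.le
    have hHθc : Continuous fun w => Hsq r w * θ r w :=
      ((h.continuous_deriv_slice hrT).norm.pow 2).mul (hθcont r hrT)
    have hHθi : Integrable (fun w => Hsq r w * θ r w) μT :=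
      integrable_of_continuous (h := gm T le_rfl) hHθc
    have hI1 : Integrable (fun w => A₀ * (Hsq r w * θ r w)) μT := hHθi.const_mul A₀
    have hI4 : Integrable (fun w => l⁻¹ * (Hsq r w * θ r w)) μT := hHθi.const_mul l⁻¹
    have hI2 : Integrable (fun w => l + l⁻¹ * (Hsq r w * θ r w)) μT := (integrable_const l).add hI4
    have hI3 : Integrable (fun w => A₁ / 2 * (l + l⁻¹ * (Hsq r w * θ r w))) μT :=
      hI2.const_mul (A₁ / 2)
    have hle : ∀ w, ‖(f' r w - Hsq r w * f r w) * θ r w‖ ≤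
        A₀ * (Hsq r w * θ r w) + A₁ / 2 * (l + l⁻¹ * (Hsq r w * θ r w)) := fun w => by
      obtain ⟨h0, h1⟩ := hB r (Ioo_subset_Icc_self hr) w
      have hθ0 := (hθpos r hrT w).le
      have hA₁ : 0 ≤ A₁ := (norm_nonneg _).trans h1
      have hd : |f' r w| ≤ A₁ * ‖deriv (fun s => F s w) r‖ := by
        rw [← Real.norm_eq_abs]
        exact (ContinuousLinearMap.le_opNorm _ _).trans
          (mul_le_mul_of_nonneg_right h1 (norm_nonneg _))
      have hpp := mul_mul_le_half_mul_add (n := ‖deriv (fun s => F s w) r‖) hA₁ hθ0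
        (hθle r hrT w) hl
      have hH0 : 0 ≤ Hsq r w := sq_nonneg _
      rw [Real.norm_eq_abs, abs_mul, abs_of_nonneg hθ0]
      calc |f' r w - Hsq r w * f r w| * θ r w
          ≤ (A₁ * ‖deriv (fun s => F s w) r‖ + Hsq r w * A₀) * θ r w := by
            refine mul_le_mul_of_nonneg_right ((abs_sub _ _).trans (add_le_add hd ?_)) hθ0
            rw [abs_mul, abs_of_nonneg hH0]
            exact mul_le_mul_of_nonneg_left h0 hH0
        _ = A₁ * ‖deriv (fun s => F s w) r‖ * θ r w + A₀ * (Hsq r w * θ r w) := by ring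
        _ ≤ A₁ / 2 * (l + l⁻¹ * (‖deriv (fun s => F s w) r‖ ^ 2 * θ r w)) +
              A₀ * (Hsq r w * θ r w) := add_le_add hpp le_rfl
        _ = A₀ * (Hsq r w * θ r w) + A₁ / 2 * (l + l⁻¹ * (Hsq r w * θ r w)) := by
            simp only [hHsq]; ring
    calc |g' r| = ‖∫ w, (f' r w - Hsq r w * f r w) * θ r w ∂μT‖ := (Real.norm_eq_abs _).symm
      _ ≤ ∫ w, A₀ * (Hsq r w * θ r w) + A₁ / 2 * (l + l⁻¹ * (Hsq r w * θ r w)) ∂μT :=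
          norm_integral_le_of_norm_le (hI1.add hI3) (Eventually.of_forall hle)
      _ = A₀ * Φ r + A₁ / 2 * (l * AT + l⁻¹ * Φ r) := by
          rw [integral_add hI1 hI3, integral_const_mul, integral_const_mul,
            integral_add (integrable_const l) hI4, integral_const_mul, integral_const, smul_eq_mul,
            measureReal_def]
          change A₀ * Φ r + A₁ / 2 * (AT * l + l⁻¹ * Φ r) = _
          ring
  -- (9) FTC inequalities for the right derivative on `[T, t]`, for every `λ > 0`
  have hFTC : ∀ l : ℝ, 0 < l →
      |g t - g T| ≤ A₀ * IΦ + A₁ / 2 * (l * ((t - T) * AT) + l⁻¹ * IΦ) := by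
    intro l hl
    have hbi : IntegrableOn (fun r => A₀ * Φ r + A₁ / 2 * (l * AT + l⁻¹ * Φ r)) (Icc T t) :=
      (hintIcc.const_mul A₀).add (((integrableOn_const (measure_Icc_lt_top.ne)).add
        (hintIcc.const_mul l⁻¹)).const_mul (A₁ / 2))
    have hderiv : ∀ r ∈ Ioo T t, HasDerivWithinAt g (g' r) (Ioi r) r := fun r hr =>
      (hgd r hr.1).hasDerivWithinAt
    have hup : g t - g T ≤ ∫ r in T..t, A₀ * Φ r + A₁ / 2 * (l * AT + l⁻¹ * Φ r) :=
      intervalIntegral.sub_le_integral_of_hasDeriv_right_of_le ht hgc hderiv hbi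
        fun r hr => (le_abs_self _).trans (hbound hl r hr)
    have hdown : ∫ r in T..t, -(A₀ * Φ r + A₁ / 2 * (l * AT + l⁻¹ * Φ r)) ≤ g t - g T :=
      intervalIntegral.integral_le_sub_of_hasDeriv_right_of_le ht hgc hderiv hbi.neg
        fun r hr => neg_le.1 ((neg_le_abs _).trans (hbound hl r hr))
    have hΦii : IntervalIntegrable Φ volume T t :=
      (intervalIntegrable_iff_integrableOn_Ioc_of_le ht).2 hintIoc
    have hval : ∫ r in T..t, A₀ * Φ r + A₁ / 2 * (l * AT + l⁻¹ * Φ r) =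
        A₀ * IΦ + A₁ / 2 * (l * ((t - T) * AT) + l⁻¹ * IΦ) := by
      have hJ1 : IntervalIntegrable (fun r => A₀ * Φ r) volume T t := hΦii.const_mul A₀
      have hJ4 : IntervalIntegrable (fun r => l⁻¹ * Φ r) volume T t := hΦii.const_mul l⁻¹
      have hJ0 : IntervalIntegrable (fun _ => l * AT) volume T t := intervalIntegrable_const
      have hJ2 : IntervalIntegrable (fun r => l * AT + l⁻¹ * Φ r) volume T t := hJ0.add hJ4
      have hJ3 : IntervalIntegrable (fun r => A₁ / 2 * (l * AT + l⁻¹ * Φ r)) volume T t :=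
        hJ2.const_mul (A₁ / 2)
      rw [intervalIntegral.integral_add hJ1 hJ3, intervalIntegral.integral_const_mul,
        intervalIntegral.integral_const_mul, intervalIntegral.integral_add hJ0 hJ4,
        intervalIntegral.integral_const_mul, intervalIntegral.integral_const_mul,
        intervalIntegral.integral_const, smul_eq_mul, intervalIntegral.integral_of_le ht]
    rw [intervalIntegral.integral_neg, hval] at hdown
    rw [hval] at hup
    exact abs_le.2 ⟨by linarith, hup⟩
  -- (10) optimise `λ` and translate back to `(F r)^* μH⁴`
  have hopt : |g t - g T| ≤ A₀ * IΦ + A₁ * Real.sqrt ((t - T) * AT * IΦ) :=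
    le_add_mul_sqrt_of_forall_pos (mul_nonneg (sub_nonneg.2 ht) ENNReal.toReal_nonneg) hIΦ0 hFTC
  have hG1 : ∀ s (hs : T ≤ s), (c : ℝ) * ∫ x, φ (F s x)
      ∂(Measure.comap (F s) (μH[4] : Measure (EuclideanSpace ℝ (Fin 6)))) = g s := fun s hs =>
    (h.mul_integral_comp_comap_eq hs hHE φ).trans (hchangeG s hs T le_rfl (f s)).symm
  refine le_of_mul_le_mul_left ?_ hcpos
  calc (c : ℝ) * |∫ x, φ (F t x) ∂(Measure.comap (F t) (μH[4] : Measure (EuclideanSpace ℝ (Fin 6)))) -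
          ∫ x, φ (F T x) ∂(Measure.comap (F T) (μH[4] : Measure (EuclideanSpace ℝ (Fin 6))))|
        = |g t - g T| := by
          rw [← hG1 t ht, ← hG1 T le_rfl, ← mul_sub, abs_mul, abs_of_pos hcpos]
    _ ≤ A₀ * IΦ + A₁ * Real.sqrt ((t - T) * AT * IΦ) := hopt
    _ = _ := by
          rw [hATeq, hIΦc, sqrt_mul_mul_mul_eq hcpos.le]
          ring

end Shift

/-- **Registered helper `helper_shiftLemma` (W2-D): the shift lemma along a cylinder flow.** Along
a smooth mean curvature flow `IsCylinderMCF M F ν T` of closed embedded cross-sections of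
`N = S⁴ × ℝ ⊂ ℝ⁶`, for a `C¹` test function `φ : ℝ⁶ → ℝ` with `|φ| ≤ A₀` and `‖Dφ‖ ≤ A₁` along
`F([t', t] × M)` (`T ≤ t' ≤ t`), the area measures `μ_r = (F r)^* μH⁴` of two slices satisfy
`|∫ φ∘F_t dμ_t - ∫ φ∘F_{t'} dμ_{t'}| ≤ A₀ D + A₁ √((t - t') μH⁴(F_{t'}(M)) D)` with
`D = ∫⁻_{[t',t]} ∫⁻ ‖∂_r F‖² dμ_r dr` the dissipation over `[t', t]` (transport formula + FTC
+ Peter–Paul/Cauchy–Schwarz; `IsCylinderMCF.abs_integral_comp_sub_le` for the flow restarted at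
`t'`, `IsCylinderMCF.of_le`). Classically the mass-continuity estimate of Brakke flows.
[cite: Brakke1978, §3] [cite: Huisken1984, §3] -/
theorem helper_shiftLemma : ∀ (M : Type) [TopologicalSpace M] [T2Space M] [SecondCountableTopology M] [ChartedSpace (EuclideanSpace ℝ (Fin 4)) M] [IsManifold (𝓡 4) ∞ M] [CompactSpace M] [MeasurableSpace M] [BorelSpace M] (F : ℝ → M → EuclideanSpace ℝ (Fin 6)) (ν : ℝ → M → EuclideanSpace ℝ (Fin 6)) (T : ℝ), IsCylinderMCF M F ν T → ∀ (φ : EuclideanSpace ℝ (Fin 6) → ℝ), ContDiff ℝ 1 φ → ∀ (A₀ A₁ t' t : ℝ), T ≤ t' → t' ≤ t → (∀ r ∈ Set.Icc t' t, ∀ x : M, |φ (F r x)| ≤ A₀ ∧ ‖fderiv ℝ φ (F r x)‖ ≤ A₁) → |∫ x, φ (F t x) ∂(Measure.comap (F t) (μH[4] : Measure (EuclideanSpace ℝ (Fin 6)))) - ∫ x, φ (F t' x) ∂(Measure.comap (F t') (μH[4] : Measure (EuclideanSpace ℝ (Fin 6))))| ≤ A₀ * (∫⁻ r in Set.Icc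 t' t, ∫⁻ x, ENNReal.ofReal (‖deriv (fun s => F s x) r‖ ^ 2) ∂(Measure.comap (F r) (μH[4] : Measure (EuclideanSpace ℝ (Fin 6))))).toReal + A₁ * Real.sqrt ((t - t') * (μH[4] (Set.range (F t'))).toReal * (∫⁻ r in Set.Icc t' t, ∫⁻ x, ENNReal.ofReal (‖deriv (fun s => F s x) r‖ ^ 2) ∂(Measure.comap (F r) (μH[4] : Measure (EuclideanSpace ℝ (Fin 6))))).toReal) := by
  intro M _ _ _ _ _ _ _ _ F ν T hF φ hφ A₀ A₁ t' t hTt' ht hB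
  exact (hF.of_le hTt').abs_integral_comp_sub_le hφ ht hB

end Summit.SmoothPoincare4.SmoothPoincare4.Cruxes.CylinderRungTwo.KillingFlux

end
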